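import Summits.HodgeConjecture.HodgeConjecture.Theorems.Ring2AbelianAllFrameRankFour
import Summits.HodgeConjecture.HodgeConjecture.Theorems.Ring2AbelianAllWeilFloorRebase
import Summits.HodgeConjecture.HodgeConjecture.Theorems.Ring2AbelianAllLandherr
import HarnessLib

/-!
# Ring 2 · AbelianAll (typer1, Frame IV re-based) — the `E`-rank-4 frame over the REFEREED Weil floor with the
  Landherr binder DISCHARGED and no van Geemen existence binder

research route, not a corollary; conditional on HC_CM plus one named minimal statement.
Cell line: research route conditional on HC_CM; not a corollary; Q11.4-sentence-2 already refuted in dim ≥ 3.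
`HC_CM` (`Theses.RankFourFaces.CMAbelianHodge`) is the CONCLUSION of the theorems below, obtained from NAMED refereed facts
kept as HYPOTHESES (André 1992, Hazama 2003, Koike 2004, Schoen 1998, Markman 2023), the cell's OPEN item
`Theses.RankFourFaces.RankFourWeilClasses` (stmt-HodgeConjecture-16268) as a HYPOTHESIS, and an honest fourfold residual as a
HYPOTHESIS; no case of the Hodge conjecture is proved here. This is the typer1-owned part of the cell's `(hL)` re-base round
(RING2-MAP §LEAD gen 18, L18.3 (iv)): Frame IV's
`HC_CM_of_andre_of_hazama_of_refereedFloor_of_residual_of_rankFourWeilClasses` carried the binders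
`(hL : LandherrSplitCriterion)` and `(hE : PolarizedWeilDiscriminantExists)`; both cell nodes are now THEOREMS of the tree
(`landherrSplitCriterion_holds`, ab-weil-2 `Ring2AbelianAllLandherr`, from Landherr 1936 via the Literature converse;
`polarizedWeilDiscriminantExists_holds`, ab-weil-1 `Ring2AbelianAllWeilFloorRebase`, from van Geemen 1994 Lemma 5.2), so the
frame is re-exported WITHOUT them. One term each; hygiene, not a new node.

* `HC_CM_of_andre_of_hazama_of_refereedFloor_of_residual_of_rankFourWeilClasses''` — binders: André, Hazama, Koike, Schoen,
  Markman 2023, `WeilFourfoldResidual`, `RankFourWeilClasses`.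
* `HC_CM_of_andre_of_hazama_of_refereedFloor_of_residualSq_of_rankFourWeilClasses''` — same over the squarefree residual
  `WeilFourfoldResidualSq`.
* `HC_CM_of_andre_of_hazama_of_refereedFloor_of_positive_residualSq_of_rankFourWeilClasses'` — same over the POSITIVE
  squarefree residual only (the sign-`-1` fourfold components are empty, ab-weil-1 gen 7).

## References
* Y. André, *Une remarque à propos des cycles de Hodge de type CM*, Sém. Théorie des Nombres Paris 1989–90, PM 102 (1992). [Andre1992RemarqueCM]
* F. Hazama, *Hodge cycles on abelian varieties of CM type and general Hodge conjecture*, 2003. [Hazama2003GeneralHodgeCM]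
* K. Koike, *Algebraicity of some Weil Hodge classes*, Canad. Math. Bull. 47 (2004). [Koike2004WeilHodge]
* C. Schoen, *Addendum to: Hodge classes on self-products of a variety with an automorphism*, Compositio Math. 114 (1998). [Schoen1998HodgeWeilAddendum]
* E. Markman, *The monodromy of generalized Kummer varieties …*, JEMS 25 (2023), Thm 1.3. [Markman2023GeneralizedKummers]
* W. Landherr, *Äquivalenz Hermitescher Formen über einem beliebigen algebraischen Zahlkörper*, Abh. Math. Sem. Hamburg 11 (1936). [Landherr1936HermitianForms]
* B. van Geemen, *An introduction to the Hodge conjecture for abelian varieties*, LNM 1594 (1994), Lemma 5.2. [vanGeemen1994HodgeAV]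
-/

set_option linter.dupNamespace false

namespace Summit.HodgeConjecture.HodgeConjecture.Ring2.AbelianAll

open CategoryTheory
open Literature.AlgebraicGeometry Literature.AlgebraicGeometry.Motives
open Literature.AlgebraicGeometry.HodgeTheory
open Literature.AlgebraicGeometry.VanGeemen1994
open Summit.HodgeConjecture.HodgeConjecture
open Summit.HodgeConjecture.HodgeConjecture.Theses
open Summit.HodgeConjecture.HodgeConjecture.Theses.RankFourFaces (CMAbelianHodge RankFourWeilClasses)
open Summit.HodgeConjecture.HodgeConjecture.WeilTypeLadder
open Summit.HodgeConjecture.HodgeConjecture.Ring2.Hypotheses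

/-- `HC_CM` from the refereed floor, the plain fourfold residual and the `E`-rank-4 item — NO Landherr binder, NO van Geemen
existence binder (both discharged in the tree). research route, not a corollary; conditional on HC_CM plus one named minimal
statement. [cite: Landherr1936HermitianForms, Satz (local–global for Hermitian forms)] [cite: vanGeemen1994HodgeAV, Lemma 5.2] -/
theorem HC_CM_of_andre_of_hazama_of_refereedFloor_of_residual_of_rankFourWeilClasses''
    (h𝔄 : Andre1992_hodgeClasses_cmAbelianVariety_mem_span_pullback_weilClasses)
    (h83 : Hazama2003_generalHodge_cmType_of_hodge_codimTwo)
    (hK : Koike2004_weilClasses_algebraic_hyperbolicSixfold_one)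
    (hS : Schoen1998_weilClasses_algebraic_hyperbolicSixfold_three)
    (hM23 : Markman2023_weilClasses_algebraic_discOneWeilFourfold)
    (hR : WeilFourfoldResidual) (hR4 : RankFourWeilClasses) : CMAbelianHodge :=
  HC_CM_of_andre_of_hazama_of_markmanFourfolds_of_rankFourWeilClasses h𝔄 h83
    (markmanFourfolds_of_refereed_and_residual' hK hS landherrSplitCriterion_holds hM23 hR) hR4

/-- Same over the squarefree residual `WeilFourfoldResidualSq`. -/
theorem HC_CM_of_andre_of_hazama_of_refereedFloor_of_residualSq_of_rankFourWeilClasses''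
    (h𝔄 : Andre1992_hodgeClasses_cmAbelianVariety_mem_span_pullback_weilClasses)
    (h83 : Hazama2003_generalHodge_cmType_of_hodge_codimTwo)
    (hK : Koike2004_weilClasses_algebraic_hyperbolicSixfold_one)
    (hS : Schoen1998_weilClasses_algebraic_hyperbolicSixfold_three)
    (hM23 : Markman2023_weilClasses_algebraic_discOneWeilFourfold)
    (hR : WeilFourfoldResidualSq) (hR4 : RankFourWeilClasses) : CMAbelianHodge :=
  HC_CM_of_andre_of_hazama_of_markmanFourfolds_of_rankFourWeilClasses h𝔄 h83
    (markmanFourfolds_of_refereed_and_residualSq' hK hS landherrSplitCriterion_holds hM23 hR) hR4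

/-- Same over the POSITIVE squarefree residual only: the open fourfold cells are `(2, d₀, δ)` with `d₀` squarefree `∉ {1, 3}`,
`δ ≠ [1]` of sign `+1` (every sign-`-1` fourfold component is empty). -/
theorem HC_CM_of_andre_of_hazama_of_refereedFloor_of_positive_residualSq_of_rankFourWeilClasses'
    (h𝔄 : Andre1992_hodgeClasses_cmAbelianVariety_mem_span_pullback_weilClasses)
    (h83 : Hazama2003_generalHodge_cmType_of_hodge_codimTwo)
    (hK : Koike2004_weilClasses_algebraic_hyperbolicSixfold_one)
    (hS : Schoen1998_weilClasses_algebraic_hyperbolicSixfold_three)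
    (hM23 : Markman2023_weilClasses_algebraic_discOneWeilFourfold)
    (hR : ∀ d : ℕ, 0 < d → Squarefree d → d ≠ 1 → d ≠ 3 → ∀ δ : weilNormResidueGroup d,
      δ ≠ splitDiscriminantClass 2 d → weilSign d δ = 1 → WeilClassesComponent 2 d δ)
    (hR4 : RankFourWeilClasses) : CMAbelianHodge :=
  HC_CM_of_andre_of_hazama_of_markmanFourfolds_of_rankFourWeilClasses h𝔄 h83
    (markmanFourfolds_of_refereed_and_positive_residualSq hK hS landherrSplitCriterion_holds hM23 hR) hR4

end Summit.HodgeConjecture.HodgeConjecture.Ring2.AbelianAll
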